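import Mathlib.Analysis.Calculus.ContDiff.Operations
import Mathlib.Analysis.SpecialFunctions.Complex.Circle
import Mathlib.Analysis.SpecialFunctions.ExpDeriv
import Mathlib.Analysis.Matrix.Normed
import Mathlib.Topology.Algebra.Group.Compact
import HarnessLib

/-!
# Absorbing the CENTRE of a rank-one orbital reader into the test-function family: `F_{z(q)} (f (q, ·)) = F_1 (g q)` with `g q X := f (q, z q • X)` jointly smooth, ONE compact support
# (Rogawski 1990 §8.2 p. 119: `t_z(ψ) = z·t_1(ψ)`, `z` central; Varadarajan 1989 §6.4; Bouaziz 1994 §3.2 (I₃))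

Topic `NumberTheory/Automorphic`; namespace `Literature.NumberTheory.Automorphic.RankOneCasimir`.  THEOREMS ONLY (no `def`, no instance, no notation, no axiom, no named fact,
no `sorry`); carrier-agnostic (the reader enters through an abstract CENTRE LAW `hFz : F z f ψ = F 1 (fun X => f (z • X)) ψ` — ★ `orbitalIntegral_centre_eq` on the diagonal
carrier; the same `rw [hF, hF]` proof on the Cayley carrier `P·circleDiagonal·P⁻¹`).  Cell `pub/hodgecm-mathlib`, crux H413 (`stmt-HodgeConjecture-24833`), F0∕P3c line LH3
(letter L1 clause (I₃)), SPEC-I3 §6 step (1) of the (B-asm) recipe: the (B-desc) box head ★ p851016 ∕ two-chart edition hands a family `f : Q × M₂(ℂ) → E` read at the torus point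
`diag(e^{iθ₀}, e^{iθ₂}) = z·t_1(ν)` (centre `z = e^{i(θ₀+θ₂)∕2}`, normal angle `ν`); the (B-trans) head ★ p851048 reads a FIXED one-variable reader `Φ₁ (g q) ν`.  This file is the
adapter: with `g q X := f (q, (z q : ℂ) • X)` (F0P3a-p08 (g23)),
* `contDiff_uncurry_centreAbsorb` — `g` is jointly `C^∞` if `f` is and `q ↦ (z q : ℂ)` is;
* `exists_isCompact_forall_centreAbsorb_eq_zero` — ONE compact `X`-support for `g` from one for `f` (`C′ = S¹⁻¹ • C`, the image of `S¹ × C`);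
* `reader_centre_family_eq` — `F (z q) (fun X => f (q, X)) ψ = F 1 (g q) ψ` for every `q, ψ` under the centre law (and the split twin is the same statement for `Λ_θ`, `θ ↦ e^{iθ}`);
* `centreAbsorb_eq_of_eq` — `g q = g q′` whenever `f (q, ·) = f (q′, ·)` and `z q = z q′` (so `g ∘ π = g` follows from the box head's tangential clause).
HONEST LABEL: count-neutral plumbing; HC_CM is proved only modulo the 7 printed citations (2 remaining: hLiu418 = stmt-HodgeConjecture-24832, h413 = stmt-HodgeConjecture-24833)
until rung 0 closes.

## References
* [Rogawski1990] J. D. Rogawski, *Automorphic Representations of Unitary Groups in Three Variables*, Ann. of Math. Stud. 123 (1990), §8.2 p. 119 (the centre of `U(1,1)`).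
* [Varadarajan1989] V. S. Varadarajan, *An Introduction to Harmonic Analysis on Semisimple Lie Groups* (1989), §6.4 (`F_f` on `U(1,1)`∕`SL(2,ℝ)`).
* [Bouaziz1994IntegralesOrbitales] A. Bouaziz, *Intégrales orbitales sur les groupes de Lie réductifs*, Ann. Sci. ÉNS 27 (1994), §3.2 (I₃) p. 580.
-/

set_option autoImplicit false

open Set Function Complex
open scoped ContDiff Pointwise Matrix.Norms.Operator

namespace Literature.NumberTheory.Automorphic.RankOneCasimir

section Smooth

variable {Q : Type*} [NormedAddCommGroup Q] [NormedSpace ℝ Q] {E : Type*} [NormedAddCommGroup E] [NormedSpace ℝ E] {n : Type*} [Fintype n]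

/-- **The centre-absorbed family is jointly smooth**: `(q, X) ↦ f (q, c q • X)` is `C^∞` for `f` `C^∞` and `q ↦ c q ∈ ℂ` `C^∞`. [cite: Rogawski1990, §8.2 p. 119] -/
theorem contDiff_uncurry_centreAbsorb (f : Q × Matrix n n ℂ → E) (hf : ContDiff ℝ ∞ f) (c : Q → ℂ) (hc : ContDiff ℝ ∞ c) :
    ContDiff ℝ ∞ (uncurry fun (q : Q) (X : Matrix n n ℂ) => f (q, c q • X)) := by
  have h : ContDiff ℝ ∞ fun p : Q × Matrix n n ℂ => (p.1, c p.1 • p.2) := contDiff_fst.prodMk ((hc.comp contDiff_fst).smul contDiff_snd)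
  exact hf.comp h

omit [NormedAddCommGroup Q] [NormedSpace ℝ Q] [NormedSpace ℝ E] [Fintype n] in
/-- **ONE compact support after absorbing a UNIT-CIRCLE centre**: if `f (q, X) = 0` off a compact `C` for all `q`, then `f (q, (z q : ℂ) • X) = 0` off the compact
`{(u⁻¹ : ℂ) • X | u ∈ S¹, X ∈ C}` for all `q`. [cite: Rogawski1990, §8.2 p. 119] -/
theorem exists_isCompact_forall_centreAbsorb_eq_zero [TopologicalSpace Q] (f : Q × Matrix n n ℂ → E) {C : Set (Matrix n n ℂ)} (hC : IsCompact C)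
    (h0 : ∀ q X, X ∉ C → f (q, X) = 0) (z : Q → Circle) :
    ∃ C' : Set (Matrix n n ℂ), IsCompact C' ∧ ∀ q X, X ∉ C' → f (q, ((z q : ℂ)) • X) = 0 := by
  refine ⟨(fun p : ℂ × Matrix n n ℂ => p.1 • p.2) '' (Metric.sphere (0 : ℂ) 1 ×ˢ C), ?_, fun q X hX => h0 q _ fun hmem => hX ?_⟩
  · exact ((isCompact_sphere (0 : ℂ) 1).prod hC).image (continuous_fst.smul continuous_snd)
  · refine ⟨(((z q : ℂ))⁻¹, (z q : ℂ) • X), ⟨?_, hmem⟩, ?_⟩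
    · simp
    · simp only [smul_smul, inv_mul_cancel₀ (Circle.coe_ne_zero (z q)), one_smul]

end Smooth

section Algebra

variable {Q : Type*} {E : Type*} {n : Type*}

/-- **THE CENTRE LAW IN FAMILY FORM**: under `F z f ψ = F 1 (f ∘ (z • ·)) ψ` (★ `orbitalIntegral_centre_eq`'s conclusion, taken as a hypothesis so that any carrier fits),
`F (z q) (fun X => f (q, X)) ψ = F 1 (fun X => f (q, (z q : ℂ) • X)) ψ`. [cite: Rogawski1990, §8.2 p. 119] [cite: Varadarajan1989, §6.4] -/
theorem reader_centre_family_eq {R : Type*} (F : Circle → (Matrix n n ℂ → E) → ℝ → R)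
    (hFz : ∀ (z : Circle) (g : Matrix n n ℂ → E) (ψ : ℝ), F z g ψ = F 1 (fun X => g ((z : ℂ) • X)) ψ)
    (f : Q × Matrix n n ℂ → E) (z : Q → Circle) (q : Q) (ψ : ℝ) :
    F (z q) (fun X => f (q, X)) ψ = F 1 (fun X => f (q, ((z q : ℂ)) • X)) ψ :=
  hFz (z q) _ ψ

/-- The absorbed family depends on `q` only through `f (q, ·)` and `z q` (so the box head's tangential clause `f (c, ·) = f (π c, ·)` and `z c = z (π c)` give `g c = g (π c)`).
[cite: Bouaziz1994IntegralesOrbitales, §3.2 (I₃) p. 580] -/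
theorem centreAbsorb_eq_of_eq (f : Q × Matrix n n ℂ → E) (z : Q → Circle) {q q' : Q} (hf : ∀ X, f (q, X) = f (q', X)) (hz : z q = z q') :
    (fun X : Matrix n n ℂ => f (q, ((z q : ℂ)) • X)) = fun X => f (q', ((z q' : ℂ)) • X) := by
  funext X; rw [hz, hf]

end Algebra

section Centre

variable {Q : Type*} [NormedAddCommGroup Q] [NormedSpace ℝ Q]

/-- **The centre as a smooth function of the chart coordinates**: `q ↦ (Circle.exp (ℓ q) : ℂ)` is `C^∞` for a continuous linear `ℓ` (e.g. the mean angle `(c w 0 + c w 2)∕2`).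
[cite: Rogawski1990, §8.2 p. 119] -/
theorem contDiff_coe_circleExp_comp_clm (ℓ : Q →L[ℝ] ℝ) : ContDiff ℝ ∞ fun q : Q => ((Circle.exp (ℓ q) : Circle) : ℂ) := by
  have h : (fun q : Q => ((Circle.exp (ℓ q) : Circle) : ℂ)) = fun q => Complex.exp ((ℓ q : ℂ) * I) := by
    funext q; rw [Circle.coe_exp]
  rw [h]
  exact (Complex.contDiff_exp (𝕜 := ℝ)).comp (((Complex.ofRealCLM.contDiff.comp ℓ.contDiff)).mul contDiff_const)

end Centre

end Literature.NumberTheory.Automorphic.RankOneCasimir
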